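import Summits.Ventures.PercRepro.ProfilePointedCircuitClassesStarSharpDefectC

/-!
# PercRepro — (L0) THE DEFECTS OF `R` ARE AT MOST THREE, PART D: THE DEFECT SET AND ITS RANK FACTS
(p5, gen 55; `proofs/P5-GM1.md` §82 ADD 5–6)

The defects of `R` are the pairs `π ⊆ X = E₇ − e − f` with `ρ(π + e) = 3`, `(X − π) + f` a basis and no swap
(`¬ (ρ(π + f) = 3 ∧ ρ((X − π) + e) = 4)`); they do not involve `b`.  A defect is **B1** (`e ∈ cl(X − π)`) or **B2**
(`f ∈ cl(π)`).  This file collects the rank facts: a B1 endpoint `c` has `ρ(X − c) = 4` and is `e`-collinear with no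
other point of `X`; two B1 defects at a vertex put `e` on the line of the two points outside them; a B2 defect meets
every defect; two B2 defects at a vertex `a` put their other ends on a line through `a`, which then carries every B1
endpoint; three B2 defects at a vertex are impossible.  Part E assembles `card_d0Def_le_three`.
-/

open scoped Matroid

namespace PercRepro.Cogirth

open Finset ThmH Skew Shadow Profile

open Classical

variable {α : Type} [DecidableEq α] {N : Matroid α} [N.Finite]

section StarSharpDefectD

variable {b b' : α}

/-- **THE DEFECTS OF `R`** (§82 ADD 5): the pairs `π ⊆ X` with `ρ(π + e) = 3`, `(X − π) + f` a basis and no swap. -/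
noncomputable def d0Def (N : Matroid α) [N.Finite] (b b' e f : α) : Finset (Finset α) :=
  (((((gr N).erase b).erase b').erase f).erase e).powerset.filter (fun π => π.card = 2 ∧
    rk N (insert e π) = 3 ∧ rk N (insert f (((((gr N).erase b).erase b').erase f).erase e \ π)) = 4 ∧
    ¬ (rk N (insert f π) = 3 ∧ rk N (insert e (((((gr N).erase b).erase b').erase f).erase e \ π)) = 4))

/-- Membership in `d0Def`, unfolded. -/
theorem mem_d0Def {e f : α} {π : Finset α} : π ∈ d0Def N b b' e f ↔
    π ⊆ ((((gr N).erase b).erase b').erase f).erase e ∧ π.card = 2 ∧ rk N (insert e π) = 3 ∧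
    rk N (insert f (((((gr N).erase b).erase b').erase f).erase e \ π)) = 4 ∧
    ¬ (rk N (insert f π) = 3 ∧ rk N (insert e (((((gr N).erase b).erase b').erase f).erase e \ π)) = 4) := by
  simp only [d0Def, mem_filter, mem_powerset]

/-- `|X| = 5`. -/
theorem card_X_eq_five (hn : (gr N).card = 9) (h : SeriesPair N b b') {e f : α} (he : e ∈ gr N) (hf : f ∈ gr N)
    (hef : e ≠ f) (heb : e ≠ b) (heb' : e ≠ b') (hfb : f ≠ b) (hfb' : f ≠ b') :
    (((((gr N).erase b).erase b').erase f).erase e).card = 5 := by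
  have hb : b ∈ gr N := h.1
  have hb' : b' ∈ gr N := h.2.1
  have hbb' : b ≠ b' := h.2.2.1
  have heE : e ∈ ((gr N).erase b).erase b' := mem_erase.2 ⟨heb', mem_erase.2 ⟨heb, he⟩⟩
  have hfE : f ∈ ((gr N).erase b).erase b' := mem_erase.2 ⟨hfb', mem_erase.2 ⟨hfb, hf⟩⟩
  rw [card_erase_of_mem (mem_erase.2 ⟨hef, heE⟩), card_erase_of_mem hfE,
    card_erase_of_mem (mem_erase.2 ⟨hbb'.symm, hb'⟩), card_erase_of_mem hb, hn]

/-- A defect is B1 (`ρ((X − π) + e) = 3`) or B2 (`ρ(π + f) = 2`). -/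
theorem b1_or_b2_of_mem_d0Def (hn : (gr N).card = 9) (h : SeriesPair N b b') {e f : α} (he : e ∈ gr N) (hf : f ∈ gr N)
    (hef : e ≠ f) (heb : e ≠ b) (heb' : e ≠ b') (hfb : f ≠ b) (hfb' : f ≠ b') {π : Finset α}
    (hπ : π ∈ d0Def N b b' e f) :
    rk N (insert e (((((gr N).erase b).erase b').erase f).erase e \ π)) = 3 ∨ rk N (insert f π) = 2 := by
  obtain ⟨hπX, hπ2, hπe, hYf, hno⟩ := mem_d0Def.1 hπ
  have hX5 := card_X_eq_five hn h he hf hef heb heb' hfb hfb'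
  have hXg : ((((gr N).erase b).erase b').erase f).erase e ⊆ gr N :=
    (erase_subset _ _).trans ((erase_subset _ _).trans ((erase_subset _ _).trans (erase_subset _ _)))
  have hπg : π ⊆ gr N := hπX.trans hXg
  have hτg : ((((gr N).erase b).erase b').erase f).erase e \ π ⊆ gr N := sdiff_subset.trans hXg
  have h1 := rk_insert_le_add_one (N := N) hf (X := π) hπg
  have h2 := rk_le_card' (M := N) π
  have h3 := rk_insert_le_add_one (N := N) he (X := ((((gr N).erase b).erase b').erase f).erase e \ π) hτg
  have h4 := rk_le_card' (M := N) (((((gr N).erase b).erase b').erase f).erase e \ π)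
  have h5 := rk_insert_le_add_one (N := N) hf (X := ((((gr N).erase b).erase b').erase f).erase e \ π) hτg
  have h6 : rk N π ≤ rk N (insert f π) := rk_mono' (subset_insert _ _)
  have h7 : rk N (((((gr N).erase b).erase b').erase f).erase e \ π) ≤
      rk N (insert e (((((gr N).erase b).erase b').erase f).erase e \ π)) := rk_mono' (subset_insert _ _)
  have h8 := rk_insert_le_add_one (N := N) he (X := π) hπg
  have hτc : (((((gr N).erase b).erase b').erase f).erase e \ π).card = 3 := by
    rw [card_sdiff_of_subset hπX, hX5, hπ2]
  rw [hπ2] at h2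
  rw [hτc] at h4
  by_contra hcon
  push Not at hcon
  apply hno
  omega

/-- **(P1)**: an endpoint `c` of a B1 defect has `ρ(X − c) = 4`. -/
theorem rk_erase_eq_four_of_b1 (hn : (gr N).card = 9) (h : SeriesPair N b b') {e f : α} (he : e ∈ gr N) (hf : f ∈ gr N)
    (hef : e ≠ f) (heb : e ≠ b) (heb' : e ≠ b') (hfb : f ≠ b) (hfb' : f ≠ b')
    (hfc : ∀ y ∈ ((((gr N).erase b).erase b').erase f).erase e, rk N (((((gr N).erase b).erase b').erase f).erase y) = 4)
    {π : Finset α} (hπX : π ⊆ ((((gr N).erase b).erase b').erase f).erase e) (hπ2 : π.card = 2)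
    (hYf : rk N (insert f (((((gr N).erase b).erase b').erase f).erase e \ π)) = 4)
    (hB1 : rk N (insert e (((((gr N).erase b).erase b').erase f).erase e \ π)) = 3) {c : α} (hc : c ∈ π) :
    rk N ((((((gr N).erase b).erase b').erase f).erase e).erase c) = 4 := by
  have hcX : c ∈ ((((gr N).erase b).erase b').erase f).erase e := hπX hc
  have hXg : ((((gr N).erase b).erase b').erase f).erase e ⊆ gr N :=
    (erase_subset _ _).trans ((erase_subset _ _).trans ((erase_subset _ _).trans (erase_subset _ _)))
  have hτg : ((((gr N).erase b).erase b').erase f).erase e \ π ⊆ gr N := sdiff_subset.trans hXg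
  have h5 := rk_insert_le_add_one (N := N) hf (X := ((((gr N).erase b).erase b').erase f).erase e \ π) hτg
  have h4 := rk_le_card' (M := N) (((((gr N).erase b).erase b').erase f).erase e \ π)
  have hX5 := card_X_eq_five hn h he hf hef heb heb' hfb hfb'
  have hτc : (((((gr N).erase b).erase b').erase f).erase e \ π).card = 3 := by
    rw [card_sdiff_of_subset hπX, hX5, hπ2]
  rw [hτc] at h4
  have hτ3 : rk N (((((gr N).erase b).erase b').erase f).erase e \ π) = 3 := by omega
  have hsub : ((((gr N).erase b).erase b').erase f).erase e \ π ⊆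
      ((((((gr N).erase b).erase b').erase f).erase e).erase c) := by
    intro u hu
    rw [mem_sdiff] at hu
    exact mem_erase.2 ⟨fun h' => hu.2 (h' ▸ hc), hu.1⟩
  have h1 := rk_insert_eq_of_rk_insert_eq_subset' (N := N) hsub (w := e) (by rw [hB1, hτ3])
  rw [insert_e_X_erase_eq he hef heb heb' hcX, hfc c hcX] at h1
  exact h1.symm

/-- A pair containing two distinct points is that pair. -/
theorem eq_pair_of_card_two {π : Finset α} (hπ2 : π.card = 2) {c c' : α} (hc : c ∈ π) (hc' : c' ∈ π) (hcc' : c ≠ c') :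
    π = {c, c'} := by
  symm
  apply eq_of_subset_of_card_le
  · intro u hu
    simp only [mem_insert, mem_singleton] at hu
    rcases hu with rfl | rfl
    · exact hc
    · exact hc'
  · rw [card_pair hcc', hπ2]

/-- Two distinct pairs through `a` have a union of three points. -/
theorem card_union_eq_three_of_ne {π₁ π₂ : Finset α} (h1 : π₁.card = 2) (h2 : π₂.card = 2) {a : α} (ha1 : a ∈ π₁)
    (ha2 : a ∈ π₂) (hne : π₁ ≠ π₂) : (π₁ ∪ π₂).card = 3 := by
  have h3 := card_union_add_card_inter π₁ π₂
  have h4 : 1 ≤ (π₁ ∩ π₂).card := card_pos.2 ⟨a, mem_inter.2 ⟨ha1, ha2⟩⟩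
  have h5 : (π₁ ∩ π₂).card < 2 := by
    by_contra h6
    apply hne
    have h7 : π₁ ∩ π₂ = π₁ := eq_of_subset_of_card_le inter_subset_left (by omega)
    apply eq_of_subset_of_card_le _ (by omega)
    intro u hu
    exact (mem_inter.1 (h7.symm ▸ hu)).2
  omega

/-- **(P7′)**: an endpoint `c` of a B1 defect is `e`-collinear with no other point of `X`: `ρ{c, u, e} = 3`. -/
theorem rk_insert_e_pair_eq_three_of_b1 {e f : α} (he : e ∈ gr N) (hef : e ≠ f) (heb : e ≠ b) (heb' : e ≠ b')
    (he1 : ∀ y ∈ ((((gr N).erase b).erase b').erase f).erase e, rk N {e, y} = 2)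
    (hfc : ∀ y ∈ ((((gr N).erase b).erase b').erase f).erase e, rk N (((((gr N).erase b).erase b').erase f).erase y) = 4)
    {π : Finset α} (hπX : π ⊆ ((((gr N).erase b).erase b').erase f).erase e) (hπ2 : π.card = 2)
    (hπe : rk N (insert e π) = 3)
    (hB1 : rk N (insert e (((((gr N).erase b).erase b').erase f).erase e \ π)) = 3) {c u : α} (hc : c ∈ π)
    (hu : u ∈ ((((gr N).erase b).erase b').erase f).erase e) (huc : u ≠ c) : rk N (insert e {c, u}) = 3 := by
  have hXg : ((((gr N).erase b).erase b').erase f).erase e ⊆ gr N :=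
    (erase_subset _ _).trans ((erase_subset _ _).trans ((erase_subset _ _).trans (erase_subset _ _)))
  by_cases huπ : u ∈ π
  · rw [← eq_pair_of_card_two hπ2 hc huπ huc.symm]; exact hπe
  obtain ⟨c', hc'π, hc'c⟩ := exists_mem_ne (by omega : 1 < π.card) c
  have hπeq : π = {c, c'} := eq_pair_of_card_two hπ2 hc hc'π hc'c.symm
  have hcX := hπX hc
  have hc'X := hπX hc'π
  by_contra hne
  have h1 : rk N (insert e {c, u}) ≤ 3 := by
    have h2 := rk_insert_le_add_one (N := N) (hXg hcX) (X := {e, u}) (insert_subset he (singleton_subset_iff.2 (hXg hu)))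
    rw [he1 u hu, insert_pair_comm3] at h2
    exact h2
  have h3 : rk N {e, u} ≤ rk N (insert e {c, u}) := rk_mono' (by
    intro a ha; simp only [mem_insert, mem_singleton] at ha ⊢; tauto)
  rw [he1 u hu] at h3
  have h4 : rk N (insert c {e, u}) = rk N {e, u} := by rw [insert_pair_comm3, he1 u hu]; omega
  have hsub : ({e, u} : Finset α) ⊆ insert e (((((gr N).erase b).erase b').erase f).erase e \ π) := by
    intro a ha; simp only [mem_insert, mem_singleton] at ha
    rcases ha with rfl | rfl
    · exact mem_insert_self _ _
    · exact mem_insert_of_mem (mem_sdiff.2 ⟨hu, huπ⟩)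
  have h5 := rk_insert_eq_of_rk_insert_eq_subset' (N := N) hsub h4
  rw [hB1] at h5
  -- `X − c' = (X − π) + c`, and `(X − c') + e` has rank `4`
  have hXc' : (((((gr N).erase b).erase b').erase f).erase e).erase c' =
      insert c (((((gr N).erase b).erase b').erase f).erase e \ π) := by
    ext a
    rw [mem_erase, mem_insert, mem_sdiff, hπeq, mem_insert, mem_singleton]
    constructor
    · rintro ⟨hac', haX⟩
      by_cases hac : a = c
      · exact Or.inl hac
      · exact Or.inr ⟨haX, by push Not; exact ⟨hac, hac'⟩⟩
    · rintro (rfl | ⟨haX, hna⟩)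
      · exact ⟨hc'c.symm, hcX⟩
      · push Not at hna; exact ⟨hna.2, haX⟩
  have h6 := hfc c' hc'X
  rw [← insert_e_X_erase_eq he hef heb heb' hc'X, hXc', insert_comm, h5] at h6
  omega

/-- **(P2)**: two B1 defects `π₁ ≠ π₂` through `a` put `e` on the line of two points outside `π₁ ∪ π₂`. -/
theorem rk_insert_e_pair_le_two_of_two_b1 {e f : α} (he : e ∈ gr N) (hef : e ≠ f) (heb : e ≠ b) (heb' : e ≠ b')
    (hfc : ∀ y ∈ ((((gr N).erase b).erase b').erase f).erase e, rk N (((((gr N).erase b).erase b').erase f).erase y) = 4)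
    {π₁ π₂ : Finset α} (h1X : π₁ ⊆ ((((gr N).erase b).erase b').erase f).erase e) (h12 : π₁.card = 2)
    (h2X : π₂ ⊆ ((((gr N).erase b).erase b').erase f).erase e) (h22 : π₂.card = 2) (hne : π₁ ≠ π₂)
    (hB1 : rk N (insert e (((((gr N).erase b).erase b').erase f).erase e \ π₁)) = 3)
    (hB2 : rk N (insert e (((((gr N).erase b).erase b').erase f).erase e \ π₂)) = 3) {a : α} (ha1 : a ∈ π₁)
    (ha2 : a ∈ π₂) {v v' : α} (hv : v ∈ ((((gr N).erase b).erase b').erase f).erase e)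
    (hv' : v' ∈ ((((gr N).erase b).erase b').erase f).erase e) (hv1 : v ∉ π₁) (hv2 : v ∉ π₂) (hv'1 : v' ∉ π₁)
    (hv'2 : v' ∉ π₂) : rk N (insert e {v, v'}) ≤ 2 := by
  have haX := h1X ha1
  apply rk_le_two_of_two_planes (N := N) (S₁ := insert e (((((gr N).erase b).erase b').erase f).erase e \ π₁))
    (S₂ := insert e (((((gr N).erase b).erase b').erase f).erase e \ π₂))
    (U := insert e ((((((gr N).erase b).erase b').erase f).erase e).erase a))
  · intro u hu
    simp only [mem_insert, mem_singleton] at hu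
    rcases hu with rfl | rfl | rfl
    · exact mem_inter.2 ⟨mem_insert_self _ _, mem_insert_self _ _⟩
    · exact mem_inter.2 ⟨mem_insert_of_mem (mem_sdiff.2 ⟨hv, hv1⟩), mem_insert_of_mem (mem_sdiff.2 ⟨hv, hv2⟩)⟩
    · exact mem_inter.2 ⟨mem_insert_of_mem (mem_sdiff.2 ⟨hv', hv'1⟩), mem_insert_of_mem (mem_sdiff.2 ⟨hv', hv'2⟩)⟩
  · intro u hu
    rw [mem_insert] at hu
    rcases hu with rfl | hu
    · exact mem_union_left _ (mem_insert_self _ _)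
    have hua := (mem_erase.1 hu).1
    have huX := (mem_erase.1 hu).2
    by_cases hu1 : u ∈ π₁
    · have hu2 : u ∉ π₂ := by
        intro hu2
        apply hne
        rw [eq_pair_of_card_two h12 ha1 hu1 hua.symm, eq_pair_of_card_two h22 ha2 hu2 hua.symm]
      exact mem_union_right _ (mem_insert_of_mem (mem_sdiff.2 ⟨huX, hu2⟩))
    · exact mem_union_left _ (mem_insert_of_mem (mem_sdiff.2 ⟨huX, hu1⟩))
  · rw [insert_e_X_erase_eq he hef heb heb' haX]; exact hfc a haX
  · rw [hB1]
  · rw [hB2]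

/-- **(A1)**: a B2 defect meets every defect. -/
theorem not_disjoint_of_b2 (hn : (gr N).card = 9) (h : SeriesPair N b b') {e f : α} (he : e ∈ gr N) (hf : f ∈ gr N)
    (hef : e ≠ f) (heb : e ≠ b) (heb' : e ≠ b') (hfb : f ≠ b) (hfb' : f ≠ b') {π σ : Finset α}
    (hπ : π ∈ d0Def N b b' e f) (hB2 : rk N (insert f π) = 2) (hσ : σ ∈ d0Def N b b' e f)
    (hdis : ∀ u ∈ π, u ∉ σ) : False := by
  obtain ⟨hπX, hπ2, hπe, -, -⟩ := mem_d0Def.1 hπ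
  obtain ⟨hσX, hσ2, -, hσY, -⟩ := mem_d0Def.1 hσ
  have hX5 := card_X_eq_five hn h he hf hef heb heb' hfb hfb'
  have hXg : ((((gr N).erase b).erase b').erase f).erase e ⊆ gr N :=
    (erase_subset _ _).trans ((erase_subset _ _).trans ((erase_subset _ _).trans (erase_subset _ _)))
  have hπ2' : rk N π = 2 := by
    have h1 := rk_insert_le_add_one (N := N) he (X := π) (hπX.trans hXg)
    have h2 := rk_le_card' (M := N) π
    rw [hπ2] at h2
    omega
  have hsub : π ⊆ ((((gr N).erase b).erase b').erase f).erase e \ σ :=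
    fun u hu => mem_sdiff.2 ⟨hπX hu, hdis u hu⟩
  have h3 := rk_insert_eq_of_rk_insert_eq_subset' (N := N) hsub (w := f) (by rw [hB2, hπ2'])
  have h4 := rk_le_card' (M := N) (((((gr N).erase b).erase b').erase f).erase e \ σ)
  rw [card_sdiff_of_subset hσX, hX5, hσ2] at h4
  rw [hσY] at h3
  omega

/-- Two B2 defects through `a` span a line: `ρ(π₁ ∪ π₂) ≤ 2`. -/
theorem rk_union_le_two_of_two_b2 {e f : α} (hf : f ∈ gr N)
    (hf1 : ∀ y ∈ ((((gr N).erase b).erase b').erase f).erase e, rk N {f, y} = 2) {π₁ π₂ : Finset α}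
    (h1X : π₁ ⊆ ((((gr N).erase b).erase b').erase f).erase e) (hB1 : rk N (insert f π₁) = 2)
    (hB2 : rk N (insert f π₂) = 2) {a : α} (ha1 : a ∈ π₁) (ha2 : a ∈ π₂) : rk N (π₁ ∪ π₂) ≤ 2 := by
  have h1 := rk_union_add_rk_le_of_subset_inter' (N := N) (S := insert f π₁) (T := insert f π₂) (I := {f, a}) (by
    intro u hu; simp only [mem_insert, mem_singleton] at hu
    rcases hu with rfl | rfl
    · exact mem_inter.2 ⟨mem_insert_self _ _, mem_insert_self _ _⟩
    · exact mem_inter.2 ⟨mem_insert_of_mem ha1, mem_insert_of_mem ha2⟩)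
  rw [hf1 a (h1X ha1), hB1, hB2] at h1
  have h2 : rk N (π₁ ∪ π₂) ≤ rk N (insert f π₁ ∪ insert f π₂) :=
    rk_mono' (union_subset_union (subset_insert _ _) (subset_insert _ _))
  omega

/-- **(A2)**: two distinct B2 defects through `a` carry every B1 endpoint: a B1 defect `σ` lies in `π₁ ∪ π₂`. -/
theorem b1_subset_union_of_two_b2 (hn : (gr N).card = 9) (h : SeriesPair N b b') {e f : α} (he : e ∈ gr N)
    (hf : f ∈ gr N) (hef : e ≠ f) (heb : e ≠ b) (heb' : e ≠ b') (hfb : f ≠ b) (hfb' : f ≠ b')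
    (hf1 : ∀ y ∈ ((((gr N).erase b).erase b').erase f).erase e, rk N {f, y} = 2)
    (hfc : ∀ y ∈ ((((gr N).erase b).erase b').erase f).erase e, rk N (((((gr N).erase b).erase b').erase f).erase y) = 4)
    {π₁ π₂ σ : Finset α} (hπ₁ : π₁ ∈ d0Def N b b' e f) (hπ₂ : π₂ ∈ d0Def N b b' e f) (hne : π₁ ≠ π₂)
    (hB1 : rk N (insert f π₁) = 2) (hB2 : rk N (insert f π₂) = 2) {a : α} (ha1 : a ∈ π₁) (ha2 : a ∈ π₂)
    (hσ : σ ∈ d0Def N b b' e f) (hσB1 : rk N (insert e (((((gr N).erase b).erase b').erase f).erase e \ σ)) = 3) :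
    σ ⊆ π₁ ∪ π₂ := by
  obtain ⟨h1X, h12, -, -, -⟩ := mem_d0Def.1 hπ₁
  obtain ⟨h2X, h22, -, -, -⟩ := mem_d0Def.1 hπ₂
  obtain ⟨hσX, hσ2, -, hσY, -⟩ := mem_d0Def.1 hσ
  have hX5 := card_X_eq_five hn h he hf hef heb heb' hfb hfb'
  have hXg : ((((gr N).erase b).erase b').erase f).erase e ⊆ gr N :=
    (erase_subset _ _).trans ((erase_subset _ _).trans ((erase_subset _ _).trans (erase_subset _ _)))
  have hU := rk_union_le_two_of_two_b2 hf hf1 h1X hB1 hB2 ha1 ha2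
  have hU3 := card_union_eq_three_of_ne h12 h22 ha1 ha2 hne
  intro c hc
  by_contra hcU
  have hcX := hσX hc
  have h4 := rk_erase_eq_four_of_b1 hn h he hf hef heb heb' hfb hfb' hfc hσX hσ2 hσY hσB1 hc
  have hsub : π₁ ∪ π₂ ⊆ (((((gr N).erase b).erase b').erase f).erase e).erase c := by
    intro u hu
    exact mem_erase.2 ⟨fun h' => hcU (h' ▸ hu), (union_subset h1X h2X) hu⟩
  have h5 := rk_union_le_rk_add_card (N := N) (π₁ ∪ π₂) ((((((gr N).erase b).erase b').erase f).erase e).erase c \ (π₁ ∪ π₂))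
  rw [union_sdiff_of_subset hsub, card_sdiff_of_subset hsub, card_erase_of_mem hcX, hX5, hU3, h4] at h5
  omega

/-- **(A6)**: three distinct B2 defects through `a` are impossible. -/
theorem not_three_b2 (hn : (gr N).card = 9) (h : SeriesPair N b b') {e f : α} (he : e ∈ gr N) (hf : f ∈ gr N)
    (hef : e ≠ f) (heb : e ≠ b) (heb' : e ≠ b') (hfb : f ≠ b) (hfb' : f ≠ b')
    (hf1 : ∀ y ∈ ((((gr N).erase b).erase b').erase f).erase e, rk N {f, y} = 2)
    (hX : rk N (((((gr N).erase b).erase b').erase f).erase e) = 4)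
    {π₁ π₂ π₃ : Finset α} (hπ₁ : π₁ ∈ d0Def N b b' e f) (hπ₂ : π₂ ∈ d0Def N b b' e f) (hπ₃ : π₃ ∈ d0Def N b b' e f)
    (h12 : π₁ ≠ π₂) (h13 : π₁ ≠ π₃) (h23 : π₂ ≠ π₃) (hB1 : rk N (insert f π₁) = 2) (hB2 : rk N (insert f π₂) = 2)
    (hB3 : rk N (insert f π₃) = 2) {a : α} (ha1 : a ∈ π₁) (ha2 : a ∈ π₂) (ha3 : a ∈ π₃) : False := by
  obtain ⟨h1X, h12c, h1e, -, -⟩ := mem_d0Def.1 hπ₁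
  obtain ⟨h2X, h22c, -, -, -⟩ := mem_d0Def.1 hπ₂
  obtain ⟨h3X, h32c, -, -, -⟩ := mem_d0Def.1 hπ₃
  have hX5 := card_X_eq_five hn h he hf hef heb heb' hfb hfb'
  have hXg : ((((gr N).erase b).erase b').erase f).erase e ⊆ gr N :=
    (erase_subset _ _).trans ((erase_subset _ _).trans ((erase_subset _ _).trans (erase_subset _ _)))
  have hU12 := rk_union_le_two_of_two_b2 hf hf1 h1X hB1 hB2 ha1 ha2
  have hU13 := rk_union_le_two_of_two_b2 hf hf1 h1X hB1 hB3 ha1 ha3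
  have hπ1r : rk N π₁ = 2 := by
    have h1 := rk_insert_le_add_one (N := N) he (X := π₁) (h1X.trans hXg)
    have h2 := rk_le_card' (M := N) π₁
    rw [h12c] at h2
    omega
  have hU := rk_union_add_rk_le_of_subset_inter' (N := N) (S := π₁ ∪ π₂) (T := π₁ ∪ π₃) (I := π₁)
    (subset_inter subset_union_left subset_union_left)
  rw [hπ1r] at hU
  -- `π₃ = {a, z}` with `z ∉ π₁ ∪ π₂`
  obtain ⟨z, hz3, hza⟩ := exists_mem_ne (by omega : 1 < π₃.card) a
  have hz12 : z ∉ π₁ ∪ π₂ := by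
    intro hz
    rcases mem_union.1 hz with hz1 | hz2
    · exact h13 (by rw [eq_pair_of_card_two h12c ha1 hz1 hza.symm, eq_pair_of_card_two h32c ha3 hz3 hza.symm])
    · exact h23 (by rw [eq_pair_of_card_two h22c ha2 hz2 hza.symm, eq_pair_of_card_two h32c ha3 hz3 hza.symm])
  have hU3 := card_union_eq_three_of_ne h12c h22c ha1 ha2 h12
  have hsub : π₁ ∪ π₂ ∪ (π₁ ∪ π₃) ⊆ ((((gr N).erase b).erase b').erase f).erase e :=
    union_subset (union_subset h1X h2X) (union_subset h1X h3X)
  have h5 := rk_union_le_rk_add_card (N := N) (π₁ ∪ π₂ ∪ (π₁ ∪ π₃))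
    (((((gr N).erase b).erase b').erase f).erase e \ (π₁ ∪ π₂ ∪ (π₁ ∪ π₃)))
  rw [union_sdiff_of_subset hsub, hX] at h5
  have h6 : (((((gr N).erase b).erase b').erase f).erase e \ (π₁ ∪ π₂ ∪ (π₁ ∪ π₃))).card ≤ 1 := by
    have h7 : ((((gr N).erase b).erase b').erase f).erase e \ (π₁ ∪ π₂ ∪ (π₁ ∪ π₃)) ⊆
        (((((gr N).erase b).erase b').erase f).erase e \ (π₁ ∪ π₂)).erase z := by
      intro u hu
      rw [mem_sdiff] at hu
      refine mem_erase.2 ⟨fun h' => hu.2 (h' ▸ mem_union_right _ (mem_union_right _ hz3)), mem_sdiff.2 ⟨hu.1, ?_⟩⟩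
      exact fun h' => hu.2 (mem_union_left _ h')
    have h8 := card_le_card h7
    rw [card_erase_of_mem (mem_sdiff.2 ⟨h3X hz3, hz12⟩), card_sdiff_of_subset (union_subset h1X h2X), hX5, hU3] at h8
    exact h8
  omega

end StarSharpDefectD

end PercRepro.Cogirth
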